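import Mathlib.Analysis.SpecialFunctions.Log.Monotone
import Literature.IUT.LogVolume.PrimeNumberEstimates
import Literature.IUT.LogVolume.EtaPrmSixtyBlocks
import Literature.IUT.LogVolume.EtaPrmSixtyIntegral
import HarnessLib

/-!
# `η_prm = 60` is admissible in [IUTchIV] Proposition 1.6: `π(x) ≤ (4/3)·x/log x` for all real `x ≥ 60`

Topic `Literature/IUT/LogVolume`. [IUTchIV] Prop. 1.6 (p. 16) asserts the EXISTENCE of `η_prm` with `Σ_{p ≤ η} 1 ≤
4η/(3·log η)` for `η ≥ η_prm` (the tree's `IsEtaPrm`, `exists_isEtaPrm` PROVED from the prime number theorem); Joshi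
[ATS IV] (arXiv:2403.10430v2) Prop. 6.2.1 takes `η_prm := 60`. This file PROVES the explicit statement — a weak form
(constant `4/3 > 1.25506`, `x ≥ 60`) of Rosser–Schoenfeld's (3.6) «`π(x) < 1.25506·x/log x` for `1 < x`» — from
results PROVED in the tree, with no named fact: `60 ≤ x < 1024` by the kernel-certified blocks of
`EtaPrmSixtyBlocks.lean` and the monotonicity of `t/log t`; `1024 ≤ x ≤ 8886113` by Abel summation (Mathlib
`Chebyshev.primeCounting_eq_theta_div_log_add_integral`) at `x` and at `1024` with the integral bounds of
`EtaPrmSixtyIntegral.lean` (the tree's certified `θ`-table `abs_theta_sub_le_smallRange`) and the couplings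
`log² x ≤ 1.5016·√x`, `log x ≤ 0.2167·√x` (from Mathlib's `Real.log_div_self_antitoneOn` at `x^{1/4}`);
`x ≥ 8886113` by the tree's Chebyshev–Sylvester bound (`theta_le_large`, `integral_large_le`) and `log x ≥ 16`.

Main results: `primeCounting_le_four_thirds` and `isEtaPrm_sixty : IsEtaPrm 60` — so [IUTchIV] Thm. 1.10 /
Joshi's Thm. 6.1.1 may be read with the explicit `η_prm = 60`, and Joshi's Prop. 6.2.1
(`Summit.ABC.IUTFork.Joshi.ATS4.Prop621`) is a theorem of the tree. Classical and undisputed; standard axioms only.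
-/

noncomputable section

namespace Literature.IUT.LogVolume

namespace EtaPrmSixty

open Real MeasureTheory Set intervalIntegral
open scoped Nat.Prime Chebyshev

/-! ## 1. Numerical constants -/

/-- `log 1024 = 10·log 2`. [folklore] -/
private theorem log_1024 : Real.log 1024 = 10 * Real.log 2 := by
  rw [show (1024 : ℝ) = 2 ^ 10 by norm_num, Real.log_pow]; norm_num

/-- `6.9314718 < log 1024 < 6.9314719`. [folklore] -/
private theorem log_1024_bounds : 6.9314718 < Real.log 1024 ∧ Real.log 1024 < 6.9314719 := by
  rw [log_1024]
  constructor <;> linarith [Real.log_two_gt_d9, Real.log_two_lt_d9]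

/-- `√1024 = 32`. [folklore] -/
private theorem sqrt_1024 : Real.sqrt 1024 = 32 := by
  rw [show (1024 : ℝ) = 32 ^ 2 by norm_num, Real.sqrt_sq (by norm_num)]

/-- `5.656854 ≤ √32`. [folklore] -/
private theorem sqrt_32_ge : (5.656854 : ℝ) ≤ Real.sqrt 32 :=
  Real.le_sqrt_of_sq_le (by norm_num)

/-- `log √32 = (5/2)·log 2 ≤ 1.732868`. [folklore] -/
private theorem log_sqrt_32_le : Real.log (Real.sqrt 32) ≤ 1.732868 := by
  rw [Real.log_sqrt (by norm_num), show (32 : ℝ) = 2 ^ 5 by norm_num, Real.log_pow]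
  have := Real.log_two_lt_d9
  push_cast
  linarith

/-- `e ≤ √32`. [folklore] -/
private theorem exp_one_le_sqrt_32 : Real.exp 1 ≤ Real.sqrt 32 := by
  have := Real.exp_one_lt_d9
  linarith [sqrt_32_ge]

/-! ## 2. The coupling bounds `log² x ≤ 1.5016 √x`, `log x ≤ 0.2167 √x` for `x ≥ 1024` -/

/-- For `x ≥ 1024`, with `v = x^{1/4} ≥ √32 ≥ e`: `log v ≤ 0.30634·v` (Mathlib's `log t/t` antitone on `[e,∞)`,
`log √32/√32 ≤ 1.732868/5.656854 < 0.30634`). [folklore] -/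
private theorem log_quarter_le {x : ℝ} (hx : 1024 ≤ x) :
    Real.log (Real.sqrt (Real.sqrt x)) ≤ 0.30634 * Real.sqrt (Real.sqrt x) := by
  set v := Real.sqrt (Real.sqrt x) with hv
  have hv0 : Real.sqrt 32 ≤ v := by
    rw [hv, ← sqrt_1024]
    exact Real.sqrt_le_sqrt (Real.sqrt_le_sqrt hx)
  have hvpos : 0 < v := lt_of_lt_of_le (Real.sqrt_pos.2 (by norm_num)) hv0
  have hanti := Real.log_div_self_antitoneOn (a := Real.sqrt 32) (b := v)
    (by simpa using exp_one_le_sqrt_32) (by simpa using le_trans exp_one_le_sqrt_32 hv0) hv0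
  -- `log v / v ≤ log √32 / √32 ≤ 0.30634`
  have h32 : Real.log (Real.sqrt 32) / Real.sqrt 32 ≤ 0.30634 := by
    rw [div_le_iff₀ (lt_of_lt_of_le (by norm_num) sqrt_32_ge)]
    have := log_sqrt_32_le
    nlinarith [sqrt_32_ge]
  have h : Real.log v / v ≤ 0.30634 := le_trans hanti h32
  rwa [div_le_iff₀ hvpos] at h

/-- `x = v⁴`, `√x = v²`, `log x = 4 log v` bookkeeping: for `x ≥ 1024`, `log x ^ 2 ≤ 1.5016·√x`. [folklore] -/
private theorem log_sq_le_sqrt {x : ℝ} (hx : 1024 ≤ x) : Real.log x ^ 2 ≤ 1.5016 * Real.sqrt x := by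
  have hx0 : 0 < x := by linarith
  set v := Real.sqrt (Real.sqrt x) with hv
  have hs : Real.sqrt x = v ^ 2 := by rw [hv, Real.sq_sqrt (Real.sqrt_nonneg x)]
  have hvpos : 0 < v := by rw [hv]; exact Real.sqrt_pos.2 (Real.sqrt_pos.2 hx0)
  have hlog : Real.log x = 4 * Real.log v := by
    have : x = v ^ 4 := by
      calc x = (Real.sqrt x) ^ 2 := (Real.sq_sqrt hx0.le).symm
        _ = (v ^ 2) ^ 2 := by rw [hs]
        _ = v ^ 4 := by ring
    rw [this, Real.log_pow]; norm_num
  have hq := log_quarter_le hx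
  rw [← hv] at hq
  have hlv : 0 ≤ Real.log v := Real.log_nonneg (by
    have : Real.sqrt 32 ≤ v := by rw [hv, ← sqrt_1024]; exact Real.sqrt_le_sqrt (Real.sqrt_le_sqrt hx)
    linarith [sqrt_32_ge])
  rw [hlog, hs]
  nlinarith [mul_le_mul hq hq hlv (by positivity)]

/-- For `x ≥ 1024`: `log x ≤ 0.2167·√x`. [folklore] -/
private theorem log_le_sqrt {x : ℝ} (hx : 1024 ≤ x) : Real.log x ≤ 0.2167 * Real.sqrt x := by
  have hx0 : 0 < x := by linarith
  set v := Real.sqrt (Real.sqrt x) with hv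
  have hs : Real.sqrt x = v ^ 2 := by rw [hv, Real.sq_sqrt (Real.sqrt_nonneg x)]
  have hv32 : Real.sqrt 32 ≤ v := by rw [hv, ← sqrt_1024]; exact Real.sqrt_le_sqrt (Real.sqrt_le_sqrt hx)
  have hvge : (5.656854 : ℝ) ≤ v := le_trans sqrt_32_ge hv32
  have hlog : Real.log x = 4 * Real.log v := by
    have : x = v ^ 4 := by
      calc x = (Real.sqrt x) ^ 2 := (Real.sq_sqrt hx0.le).symm
        _ = (v ^ 2) ^ 2 := by rw [hs]
        _ = v ^ 4 := by ring
    rw [this, Real.log_pow]; norm_num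
  have hq := log_quarter_le hx
  rw [← hv] at hq
  rw [hlog, hs]
  nlinarith

/-- For `x ≥ 1024`: `log x / x ≤ 0.00677` (antitone `log t/t`, `log 1024/1024 < 6.9314719/1024`). [folklore] -/
private theorem log_div_le {x : ℝ} (hx : 1024 ≤ x) : Real.log x / x ≤ 0.00677 := by
  have he : Real.exp 1 ≤ (1024 : ℝ) := by have := Real.exp_one_lt_d9; linarith
  have h := Real.log_div_self_antitoneOn (a := (1024 : ℝ)) (b := x) (by simpa using he)
    (by simpa using le_trans he hx) hx
  have h1024 : Real.log 1024 / 1024 ≤ 0.00677 := by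
    rw [div_le_iff₀ (by norm_num)]; linarith [log_1024_bounds.2]
  exact le_trans h h1024

/-- For `x ≥ 2^23`: `log x / x ≤ 1.9005e-6`. [folklore] -/
private theorem log_div_le' {x : ℝ} (hx : (2 : ℝ) ^ 23 ≤ x) : Real.log x / x ≤ 0.0000019005 := by
  have he : Real.exp 1 ≤ (2 : ℝ) ^ 23 := by have := Real.exp_one_lt_d9; norm_num; linarith
  have h := Real.log_div_self_antitoneOn (a := (2 : ℝ) ^ 23) (b := x) (by simpa using he)
    (by simpa using le_trans he hx) hx
  have h2 : Real.log ((2 : ℝ) ^ 23) / 2 ^ 23 ≤ 0.0000019005 := by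
    rw [Real.log_pow, div_le_iff₀ (by norm_num)]
    have := Real.log_two_lt_d9
    push_cast
    nlinarith
  exact le_trans h h2


/-- Interval-integrability of `θ(t)/(t log² t)` on `[a, b] ⊆ [2, b]` (Mathlib). [folklore] -/
private theorem intInt {a b : ℝ} (ha : 2 ≤ a) (hab : a ≤ b) :
    IntervalIntegrable (fun t ↦ θ t / (t * Real.log t ^ 2)) volume a b := by
  refine ((Chebyshev.integrableOn_theta_div_id_mul_log_sq b).mono_set ?_).intervalIntegrable
  rw [Set.uIcc_of_le hab]
  exact Set.Icc_subset_Icc ha le_rfl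

/-! ## 6. The three ranges -/

set_option maxHeartbeats 400000 in
/-- **Table range** `1024 ≤ x ≤ 8886113`: `π(⌊x⌋) ≤ 4x/(3 log x)`. [folklore] -/
private theorem main_table {x : ℝ} (hx : 1024 ≤ x) (hx' : x ≤ 8886113) :
    (π ⌊x⌋₊ : ℝ) ≤ 4 * x / (3 * Real.log x) := by
  have hx0 : (0:ℝ) < x := by linarith
  have hx2 : (2:ℝ) ≤ x := by linarith
  have hid := Chebyshev.primeCounting_eq_theta_div_log_add_integral hx2
  have hsplit : ∫ t in (2:ℝ)..x, θ t / (t * Real.log t ^ 2) =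
      (∫ t in (2:ℝ)..1024, θ t / (t * Real.log t ^ 2)) + ∫ t in (1024:ℝ)..x, θ t / (t * Real.log t ^ 2) :=
    (intervalIntegral.integral_add_adjacent_intervals (intInt le_rfl (by norm_num)) (intInt (by norm_num) hx)).symm
  have hI := integral_table_le hx hx'
  have hθx := (theta_table (by linarith) hx').2
  have hθ1024 := (theta_table (t := 1024) (by norm_num) (by norm_num)).1
  rw [sqrt_1024] at hθ1024
  obtain ⟨hl1, hl2⟩ := log_1024_bounds
  have hL : Real.log 1024 ≤ Real.log x := Real.log_le_log (by norm_num) hx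
  have hC1 := log_sq_le_sqrt hx
  have hC2 := log_le_sqrt hx
  have hC3 := log_div_le hx
  have hpi1 := Real.pi_gt_d6
  have hpi2 := Real.pi_lt_d6
  rw [hid, hsplit, integral_two_1024]
  -- atoms
  set L := Real.log x with hLdef
  set L₀ := Real.log 1024 with hL₀def
  set S := Real.sqrt x with hSdef
  set P := Real.pi with hPdef
  set T := θ x with hTdef
  set T₀ := θ 1024 with hT₀def
  have hLpos : 0 < L := by linarith
  have hL0pos : 0 < L₀ := by linarith
  have hPpos : 0 < P := by linarith
  have hS0 : 32 ≤ S := by rw [hSdef, ← sqrt_1024]; exact Real.sqrt_le_sqrt hx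
  have hss : S * S = x := Real.mul_self_sqrt hx0.le
  -- (F0) `θ(x)/L ≤ x/L + S·L/(8P)`
  have F0 : T / L ≤ x / L + S * L / (8 * P) := by
    have h := div_le_div_of_nonneg_right hθx hLpos.le
    have e : (x + S * L ^ 2 / (8 * P)) / L = x / L + S * L / (8 * P) := by field_simp
    rw [e] at h; exact h
  -- (F1) `S·L/(8P) ≤ 0.0598·(x/L)`  (from `L² ≤ 1.5016 S`, `π ≥ 3.141592`)
  have F1 : S * L / (8 * P) ≤ 0.0598 * (x / L) := by
    have h1 : S * L ^ 2 ≤ 1.5016 * x := by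
      have := mul_le_mul_of_nonneg_left hC1 (by linarith : (0:ℝ) ≤ S)
      calc S * L ^ 2 ≤ S * (1.5016 * S) := this
        _ = 1.5016 * x := by rw [← hss]; ring
    have h2 : S * L ^ 2 ≤ 0.4784 * P * x := by
      have : 1.5016 * x ≤ 0.4784 * P * x := by
        have := mul_le_mul_of_nonneg_right hpi1.le hx0.le
        linarith
      linarith
    rw [div_le_iff₀ (by positivity), show 0.0598 * (x / L) * (8 * P) = (0.4784 * P * x) / L by ring,
      le_div_iff₀ hLpos]
    calc S * L * L = S * L ^ 2 := by ring
      _ ≤ 0.4784 * P * x := h2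
  -- (F2) `(x/L²)/0.7114 ≤ 0.2029·(x/L)`  (from `L ≥ log 1024 > 6.93147`)
  have F2 : x / L ^ 2 / 0.7114 ≤ 0.2029 * (x / L) := by
    have hinv : 1 / L ≤ 0.14428 := by rw [div_le_iff₀ hLpos]; linarith
    have e : x / L ^ 2 = (x / L) * (1 / L) := by field_simp
    have hA : 0 ≤ x / L := by positivity
    have h := mul_le_mul_of_nonneg_left hinv hA
    rw [← e] at h
    have h' : x / L ^ 2 / 0.7114 ≤ x / L * 0.14428 / 0.7114 := div_le_div_of_nonneg_right h (by norm_num)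
    have h'' : x / L * 0.14428 / 0.7114 ≤ 0.2029 * (x / L) := by
      rw [div_le_iff₀ (by norm_num : (0:ℝ) < 0.7114)]
      have := mul_le_mul_of_nonneg_left (show (0.14428:ℝ) ≤ 0.2029 * 0.7114 by norm_num) hA
      linarith
    exact h'.trans h''
  -- (F3) the constant: `−θ(1024)/L₀ ≤ −1024/L₀ + 4L₀/P` and `172 − 1024/L₀ + 4L₀/P − 1024/L₀²/0.7114 − 8/P ≤ 0.6`
  have F3a : -(T₀ / L₀) ≤ -(1024 / L₀) + 4 * L₀ / P := by
    have h := div_le_div_of_nonneg_right hθ1024 hL0pos.le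
    have e : (1024 - 32 * L₀ ^ 2 / (8 * P)) / L₀ = 1024 / L₀ - 4 * L₀ / P := by field_simp; ring
    rw [e] at h; linarith
  have F3b : (0.144269 : ℝ) ≤ 1 / L₀ := by rw [le_div_iff₀ hL0pos]; linarith
  have F3c : L₀ / P ≤ 2.20636 := by rw [div_le_iff₀ hPpos]; linarith
  have F3d : (0.0208135 : ℝ) ≤ 1 / L₀ ^ 2 := by
    rw [le_div_iff₀ (by positivity)]
    have hsq : L₀ ^ 2 < 6.9314719 ^ 2 := pow_lt_pow_left₀ hl2 hL0pos.le (by norm_num)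
    norm_num at hsq
    linarith
  have F3e : (0.3183098 : ℝ) ≤ 1 / P := by rw [le_div_iff₀ hPpos]; linarith
  have F3 : 172 - 1024 / L₀ + 4 * L₀ / P - 1024 / L₀ ^ 2 / 0.7114 - 32 / (4 * P) ≤ 0.6 := by
    have e1 : 1024 / L₀ = 1024 * (1 / L₀) := by ring
    have e2 : 4 * L₀ / P = 4 * (L₀ / P) := by ring
    have e3 : 1024 / L₀ ^ 2 / 0.7114 = (1024 / 0.7114) * (1 / L₀ ^ 2) := by ring
    have e4 : 32 / (4 * P) = 8 * (1 / P) := by field_simp; ring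
    rw [e1, e2, e3, e4]
    linarith
  -- (F4) `S/(4P) ≤ 0.0173·(x/L)`  (from `L ≤ 0.2167 S`)
  have F4 : S / (4 * P) ≤ 0.0173 * (x / L) := by
    have h1 : S * L ≤ 0.2167 * x := by
      have := mul_le_mul_of_nonneg_left hC2 (by linarith : (0:ℝ) ≤ S)
      calc S * L ≤ S * (0.2167 * S) := this
        _ = 0.2167 * x := by rw [← hss]; ring
    have h2 : 0.2167 * x ≤ 0.0692 * P * x := by
      have := mul_le_mul_of_nonneg_right hpi1.le hx0.le
      linarith
    rw [div_le_iff₀ (by positivity), show 0.0173 * (x / L) * (4 * P) = (0.0692 * P * x) / L by ring,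
      le_div_iff₀ hLpos]
    linarith
  -- (F5) `x/L ≥ 147.7`
  have F5 : (147.7 : ℝ) ≤ x / L := by
    rw [le_div_iff₀ hLpos]
    have := hC3
    rw [div_le_iff₀ hx0] at this
    linarith
  -- assemble
  have eI : (x / L ^ 2 - 1024 / L₀ ^ 2) / 0.7114 = x / L ^ 2 / 0.7114 - 1024 / L₀ ^ 2 / 0.7114 := by ring
  have eS : (S - 32) / (4 * P) = S / (4 * P) - 32 / (4 * P) := by ring
  rw [eI, eS] at hI
  have hgoal : T / L + (172 - T₀ / L₀ + ∫ t in (1024:ℝ)..x, θ t / (t * Real.log t ^ 2)) ≤ 4 / 3 * (x / L) := by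
    linarith
  calc T / L + (172 - T₀ / L₀ + ∫ t in (1024:ℝ)..x, θ t / (t * Real.log t ^ 2)) ≤ 4 / 3 * (x / L) := hgoal
    _ = 4 * x / (3 * L) := by ring

/-- **Large range** `x ≥ 8886113`: `π(⌊x⌋) ≤ 4x/(3 log x)`. [folklore] -/
private theorem main_large {x : ℝ} (hx : 8886113 ≤ x) : (π ⌊x⌋₊ : ℝ) ≤ 4 * x / (3 * Real.log x) := by
  have hx0 : (0:ℝ) < x := by linarith
  have hid := Chebyshev.primeCounting_eq_theta_div_log_add_integral (x := x) (by linarith)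
  have hsplit1 : ∫ t in (2:ℝ)..x, θ t / (t * Real.log t ^ 2) =
      (∫ t in (2:ℝ)..1024, θ t / (t * Real.log t ^ 2)) + ∫ t in (1024:ℝ)..x, θ t / (t * Real.log t ^ 2) :=
    (intervalIntegral.integral_add_adjacent_intervals (intInt le_rfl (by norm_num))
      (intInt (by norm_num) (by linarith))).symm
  have hsplit2 : ∫ t in (1024:ℝ)..x, θ t / (t * Real.log t ^ 2) =
      (∫ t in (1024:ℝ)..8886113, θ t / (t * Real.log t ^ 2)) +
        ∫ t in (8886113:ℝ)..x, θ t / (t * Real.log t ^ 2) :=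
    (intervalIntegral.integral_add_adjacent_intervals (intInt (by norm_num) (by norm_num))
      (intInt (by norm_num) hx)).symm
  have hI1 := integral_table_le (x := 8886113) (by norm_num) le_rfl
  have hI2 := integral_large_le (a := 8886113) le_rfl hx
  have hθx := theta_le_large hx
  have hT0 : 0 ≤ θ 1024 := Chebyshev.theta_nonneg _
  obtain ⟨hl1, hl2⟩ := log_1024_bounds
  have h16X : (16 : ℝ) ≤ Real.log 8886113 := by
    have := Literature.NumberTheory.LFunctions.exp_sixteen_lt
    exact ((Real.lt_log_iff_exp_lt (by norm_num)).2 this).le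
  have h16 : (16 : ℝ) ≤ Real.log x := le_trans h16X (Real.log_le_log (by norm_num) hx)
  have hsqX : Real.sqrt 8886113 ≤ 2981 := by
    rw [show (2981 : ℝ) = Real.sqrt (2981 ^ 2) by rw [Real.sqrt_sq (by norm_num)]]
    exact Real.sqrt_le_sqrt (by norm_num)
  have hC3 := log_div_le' (x := x) (by norm_num at hx ⊢; linarith)
  have hpi1 := Real.pi_gt_d6
  rw [hid, hsplit1, integral_two_1024, hsplit2]
  set L := Real.log x with hLdef
  set L₀ := Real.log 1024 with hL₀def
  set LX := Real.log 8886113 with hLXdef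
  set P := Real.pi with hPdef
  set T := θ x with hTdef
  set T₀ := θ 1024 with hT₀def
  have hLpos : 0 < L := by linarith
  have hL0pos : 0 < L₀ := by linarith
  have hPpos : 0 < P := by linarith
  -- constant segment `∫_{1024}^{X₂} ≤ 49031`
  have G1 : (8886113 : ℝ) / LX ^ 2 ≤ 8886113 / 256 := by
    have hsq : (16:ℝ) ^ 2 ≤ LX ^ 2 := pow_le_pow_left₀ (by norm_num) h16X 2
    exact div_le_div_of_nonneg_left (by norm_num) (by norm_num) (by norm_num at hsq ⊢; linarith)
  have G2 : (0 : ℝ) ≤ 1024 / L₀ ^ 2 := by positivity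
  have G3 : (Real.sqrt 8886113 - 32) / (4 * P) ≤ 2981 / (4 * 3.141592) := by
    rw [div_le_div_iff₀ (by positivity) (by norm_num)]
    have := Real.sqrt_nonneg 8886113
    have h4 := mul_le_mul_of_nonneg_left hpi1.le (show (0:ℝ) ≤ 4 * 2981 by norm_num)
    nlinarith [mul_le_mul_of_nonneg_right hsqX (show (0:ℝ) ≤ 4 * 3.141592 by norm_num)]
  have G : ∫ t in (1024:ℝ)..8886113, θ t / (t * Real.log t ^ 2) ≤ 49031 := by
    have e : ((8886113 : ℝ) / LX ^ 2 - 1024 / L₀ ^ 2) / 0.7114 ≤ (8886113 / 256) / 0.7114 := by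
      apply div_le_div_of_nonneg_right _ (by norm_num); linarith
    have : (2981 : ℝ) / (4 * 3.141592) ≤ 237.24 := by norm_num
    have : ((8886113 : ℝ) / 256) / 0.7114 ≤ 48793.1 := by norm_num
    linarith
  -- `θ(x)/L ≤ 1.075·x/L`
  have H0 : T / L ≤ 1.075 * (x / L) := by
    have := div_le_div_of_nonneg_right hθx hLpos.le
    simpa [mul_div_assoc] using this
  -- tail integral `≤ 1.2286·x/L² ≤ 0.0768·(x/L)`
  have H1 : 1.075 * ((x / L ^ 2 - 8886113 / LX ^ 2) / (7 / 8)) ≤ 0.0768 * (x / L) := by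
    have hB : (0 : ℝ) ≤ 8886113 / LX ^ 2 := by positivity
    have hinv : 1 / L ≤ 1 / 16 := by
      rw [div_le_div_iff₀ hLpos (by norm_num)]; linarith
    have e : x / L ^ 2 = (x / L) * (1 / L) := by field_simp
    have hA : 0 ≤ x / L := by positivity
    have h3 : x / L ^ 2 ≤ (x / L) * (1 / 16) := by rw [e]; exact mul_le_mul_of_nonneg_left hinv hA
    have h4 : (x / L ^ 2 - 8886113 / LX ^ 2) / (7 / 8) ≤ (x / L) * (1 / 16) / (7 / 8) :=
      div_le_div_of_nonneg_right (by linarith) (by norm_num)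
    linarith
  -- constants `≤ 0.0936·(x/L)` since `x/L ≥ 526177`
  have H2 : (526177 : ℝ) ≤ x / L := by
    rw [le_div_iff₀ hLpos]
    have := hC3
    rw [div_le_iff₀ hx0] at this
    linarith
  have hT0' : 0 ≤ T₀ / L₀ := by positivity
  have hgoal : T / L + (172 - T₀ / L₀ + ((∫ t in (1024:ℝ)..8886113, θ t / (t * Real.log t ^ 2)) +
      ∫ t in (8886113:ℝ)..x, θ t / (t * Real.log t ^ 2))) ≤ 4 / 3 * (x / L) := by
    linarith
  calc _ ≤ 4 / 3 * (x / L) := hgoal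
    _ = 4 * x / (3 * L) := by ring

/-! ## 7. Main results -/

/-- **`π(x) ≤ (4/3)·x/log x` for every real `x ≥ 60`** (`π(x) = π(⌊x⌋)`): the explicit form of [IUTchIV]
Prop. 1.6's second display with `η_prm = 60`, as in Joshi [ATS IV] Prop. 6.2.1; a weak form of Rosser–Schoenfeld
(3.6) «`π(x) < 1.25506·x/log x` for `1 < x`». PROVED (blocks below `1024`, Abel summation with the tree's certified
`θ`-table up to `8886113`, Chebyshev–Sylvester beyond).
[cite: RosserSchoenfeld1962, Cor. 1 eq. (3.6) (weak form: constant 4/3, x ≥ 60)] -/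
theorem primeCounting_le_four_thirds {x : ℝ} (hx : 60 ≤ x) :
    (π ⌊x⌋₊ : ℝ) ≤ 4 * x / (3 * Real.log x) := by
  rcases lt_or_ge x 1024 with h | h
  · have hx0 : (0:ℝ) ≤ x := by linarith
    have hn60 : 60 ≤ ⌊x⌋₊ := Nat.le_floor (by exact_mod_cast hx)
    have hnlt : ⌊x⌋₊ < 1024 := (Nat.floor_lt hx0).2 (by exact_mod_cast h)
    have hb := three_mul_primeCounting_mul_log_le hn60 (by omega)
    have hn3 : (60:ℝ) ≤ (⌊x⌋₊ : ℝ) := by exact_mod_cast hn60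
    have hnx : ((⌊x⌋₊ : ℕ) : ℝ) ≤ x := Nat.floor_le hx0
    have hlogn : 0 < Real.log (⌊x⌋₊ : ℝ) := Real.log_pos (by linarith)
    have hlogx : 0 < Real.log x := Real.log_pos (by linarith)
    -- monotonicity of `t/log t` on `[e, ∞)` (Mathlib's `log t/t` antitone)
    have he : Real.exp 1 ≤ ((⌊x⌋₊ : ℕ) : ℝ) := by have := Real.exp_one_lt_d9; linarith
    have hanti := Real.log_div_self_antitoneOn (a := ((⌊x⌋₊ : ℕ) : ℝ)) (b := x) (by simpa using he)
      (by simpa using le_trans he hnx) hnx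
    have hmono : ((⌊x⌋₊ : ℕ) : ℝ) / Real.log (⌊x⌋₊ : ℝ) ≤ x / Real.log x := by
      have h' : Real.log x / x ≤ Real.log (⌊x⌋₊ : ℝ) / (⌊x⌋₊ : ℝ) := hanti
      rw [div_le_div_iff₀ (by linarith) (by linarith)] at h'
      rw [div_le_div_iff₀ hlogn hlogx]
      linarith
    calc (π ⌊x⌋₊ : ℝ) ≤ 4 * (⌊x⌋₊ : ℝ) / (3 * Real.log (⌊x⌋₊ : ℝ)) := by
          rw [le_div_iff₀ (by positivity)]; linarith
      _ = 4 / 3 * ((⌊x⌋₊ : ℝ) / Real.log (⌊x⌋₊ : ℝ)) := by ring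
      _ ≤ 4 / 3 * (x / Real.log x) := by gcongr
      _ = 4 * x / (3 * Real.log x) := by ring
  · rcases le_or_gt x 8886113 with h2 | h2
    · exact main_table h h2
    · exact main_large h2.le

/-- **`η_prm = 60` is admissible in [IUTchIV] Proposition 1.6**: `IsEtaPrm 60`, i.e. `Σ_{p ≤ η} 1 ≤ 4η/(3·log η)`
for every real `η ≥ 60` (so Thm. 1.10's `η_prm` may be taken to be `60`, as in Joshi's Thm. 6.1.1 / Rmk. 6.1.2).
PROVED. [cite: RosserSchoenfeld1962, Cor. 1 eq. (3.6) (weak form: constant 4/3, η ≥ 60)] -/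
theorem isEtaPrm_sixty : IsEtaPrm 60 :=
  ⟨by norm_num, fun η hη => primeCounting_le_four_thirds hη⟩

end EtaPrmSixty

end Literature.IUT.LogVolume

end

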